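import Summits.AtomisticToContinuum.HydrodynamicLimit.Theorems.TwoClocksEquilibriumShearWindowLD
import Summits.AtomisticToContinuum.HydrodynamicLimit.Theses.OneFlightGossipEngine

/-!
# `EquilibriumShearWindowLD` (stmt-AtomisticToContinuum-14446) from the sibling docking node of route OneFlightGossipEngine

Companion of `Theorems/TwoClocksEquilibriumShearWindowLD.lean`: the support item
`TwoClocks.EquilibriumShearWindowLD` is also an instance of
`OneFlightGossipEngine.KineticCurrentsWindowLDUniform` (stmt-AtomisticToContinuum-14662: fast currents
`Σ A_jk(x) w_j w_k + (b(x)·w) G(x,|w|²)` from local Gibbs data, η₀-uniform), at constant profiles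
`a ≡ a₀`, `u ≡ 0`, `θ ≡ θ₀`, with `A(x) = φ(x) E₀₁` (elementary matrix), `b = 0`, `G = 0`
(`kineticCurrent_shear_eq`), packing guard `σ₀ := min 1 η₀`; the orthogonality / growth / continuity
inputs are those of the companion file. Kept separate only because of its extra import.

prover-pitem-stmt-AtomisticToContinuum-14446-0.
-/

noncomputable section

open MeasureTheory Filter Topology Set
open scoped ENNReal

namespace Summit.AtomisticToContinuum.HydrodynamicLimit.Theorems

open Literature.MathematicalPhysics.KineticTheory (T3 V3 hsDiameter localGibbsLaw)
open Literature.Analysis.FluidPDE (localMaxwellian HardSphereFlow)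

/-- `(1 : Fin 3) ≠ 0`. [folklore] -/
private theorem fin3_one_ne_zero' : (1 : Fin 3) ≠ 0 := by decide

/-- The fast-current class of `OneFlightGossipEngine.KineticCurrentsWindowLDUniform` contains the
shear stress: with `A(x) = φ(x) E₀₁` (the elementary matrix), `b = 0`, `G = 0`, `u₀ = 0`, the
functional `Σ_jk A_jk(x) w_j w_k + (b(x)·w) G(x,|w|²)` is `φ(x) v⁰ v¹`. [folklore] -/
theorem kineticCurrent_shear_eq (φ : T3 → ℝ) :
    (fun y : T3 × V3 =>
        ((∑ j : Fin 3, ∑ k : Fin 3,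
            (fun x (j k : Fin 3) => if j = 0 ∧ k = 1 then φ x else 0) y.1 j k *
              ((y.2 - (fun _ : T3 => (0 : V3)) y.1) j * (y.2 - (fun _ : T3 => (0 : V3)) y.1) k)) +
          (∑ j : Fin 3, (fun _ : T3 => (0 : V3)) y.1 j * (y.2 - (fun _ : T3 => (0 : V3)) y.1) j) *
            (fun _ : T3 × ℝ => (0 : ℝ)) (y.1, ‖y.2 - (fun _ : T3 => (0 : V3)) y.1‖ ^ 2))) =
      fun y : T3 × V3 => φ y.1 * (y.2 0 * y.2 1) := by
  funext y
  simp [Fin.sum_univ_three, fin3_one_ne_zero'.symm]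

/-- **`OneFlightGossipEngine.KineticCurrentsWindowLDUniform → EquilibriumShearWindowLD`** (the
sibling route's docking node stmt-AtomisticToContinuum-14662 ⇒ support
stmt-AtomisticToContinuum-14446): constant profiles, `σ₀ := min 1 η₀`, and the shear stress as the
fast current `A = φ E₀₁`, `b = 0`, `G = 0`. [difficulty: provable-now] -/
theorem equilibriumShearWindowLD_of_kineticCurrentsWindowLDUniform
    (h : Theses.OneFlightGossipEngine.KineticCurrentsWindowLDUniform) :
    Theses.TwoClocks.EquilibriumShearWindowLD := by
  obtain ⟨η₀, hη₀, H⟩ := h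
  refine ⟨min 1 η₀, lt_min one_pos hη₀, ?_⟩
  intro a₀ θ₀ ha hθ σ hσ hσ' Φ φ hφ
  have hσ1 : σ < 1 := hσ'.trans_le (min_le_left _ _)
  have hση : σ < η₀ := hσ'.trans_le (min_le_right _ _)
  have hA : Continuous fun x (j k : Fin 3) => if j = 0 ∧ k = 1 then φ x else 0 := by
    refine continuous_pi fun j => continuous_pi fun k => ?_
    split_ifs
    · exact hφ
    · exact continuous_const
  have key := H (fun _ => a₀) (fun _ => θ₀) (fun _ => 0) continuous_const continuous_const
    continuous_const (fun _ => ha) (fun _ => hθ) σ hσ (packing_guard_const ha hσ hσ1 hση) Φ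
    (fun x (j k : Fin 3) => if j = 0 ∧ k = 1 then φ x else 0) (fun _ => 0) (fun _ => 0) hA
    continuous_const continuous_const
  rw [kineticCurrent_shear_eq φ] at key
  exact key (exists_shear_growth_bound hφ) (fun x => integral_shear_mul_localMaxwellian (φ x) θ₀)
    (fun x j => integral_shear_mul_vel_mul_localMaxwellian (φ x) θ₀ j)
    (fun x => integral_shear_mul_norm_sq_mul_localMaxwellian (φ x) θ₀)

end Summit.AtomisticToContinuum.HydrodynamicLimit.Theorems

end
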